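import Summits.FinalStateConjecture.FinalStateConjecture.Theorems.SwallowTheDatumParametricKerrBurialLine
import Summits.FinalStateConjecture.FinalStateConjecture.Theorems.SwallowTheDatumUniversalWitnessFamilyThroatSettlesToo
import Literature.Geometry.Lorentzian.ModelData
import Literature.Geometry.Lorentzian.InitialDataPullback
import Literature.Geometry.Lorentzian.AFEndAnnulusPatch
import Literature.Geometry.Lorentzian.AFEndChartEmbedding
import HarnessLib

/-!
# Stub `stub_throatTransportPatch` of the line `Sketch` (`throat-settles-too`)
(crux `SwallowTheDatum.UniversalWitnessFamily`, item stmt-FinalStateConjecture-10051)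

The registered transport-and-patch stub of the lead's skeleton, proved verbatim. Given the receding
far-gluing family `G R` (exact isotropic Schwarzschild(`m R`) beyond chart radius `32R` along the
sole end `e`, jointly smooth in `(R, x)`, `m R ≥ ηR ≥ 32 μ R`) and the dilated bag family `Cfam l`
on `ℝ³` (admissible, isotropic Schwarzschild(`lμ`) with `k = 0` on the annulus `{l < ‖y‖ < 2l}`,
THROAT-SHIELDED AWAY from radius `2l`: an open embedding `Φ : {R₁ < ‖y‖} → {2l < ‖z‖} ⊆ ℝ³`,
`R₁ < M/2`, with injective differentials, co-compact far zones and
`Φ^* (Cfam l) = ((1 + M/2‖y‖)⁴ δ, 0)` exactly; jointly smooth in `(l, y)`), set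
`l(R) = m R/μ ≥ 32R` and

  `P R := G R` inside / `coord^*(Cfam (l R))` beyond chart radius `5l(R)/4`

(`AFEnd.annulusPatch`, `AFEndAnnulusPatch.lean`). Joint smoothness in `(R, x)`, admissibility
(`AFEnd.annulusPatch_mem_admissibleVacuumData`) and the agreement with `G R` off `e.far (32R)` are
the proof of the template `stub_transportPatch`
(`Theorems/SwallowTheDatumParametricKerrBurialStubTransportPatch.lean`) verbatim. The one new piece
is §1, the throat analogue of the template's `isKerrShielded_of_far_pullback`: the located throat
shield of `Cfam (l R)` is read through the total inverse chart `Φₑ = e.dataChartExt` of the end —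
the chart `Φₑ ∘ Φ : {R₁ < ‖y‖} → X` (same `(M, R₁)`) is smooth, an open embedding
(`AFEndChartEmbedding.lean`), has injective differentials (chain rule, `dΦₑ` injective beyond the
chart radius), co-compact far zones (the far zone `{R' < ‖y‖}` is an open subset, so its image is
the range of `Φₑ ∘ (Φ ∘ incl)`, co-compact for the sole end by
`AFEnd.isCompact_compl_range_dataChartExt_comp`), and `(Φₑ ∘ Φ)^* (P R) = Φ^* (Cfam (l R))`
(`(Φₑ^* coord^* F) z = F z` beyond the chart radius, `pullbackBilin_dataChartExt_apply_of_eq`),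
which is the conformal Schwarzschild datum by hypothesis.

References: the route file `Theses/SwallowTheDatum.lean` (item 10051); Corvino 2000, §4;
Bartnik 1986, §1; O'Neill 1983, Ch. 3, p. 58; Misner–Thorne–Wheeler 1973, (31.22);
Schoen–Yau 1979, §1.
-/

-- the doubled `FinalStateConjecture` path component is the summit/problem naming scheme, not a mistake
set_option linter.dupNamespace false

noncomputable section

namespace Summit.FinalStateConjecture.FinalStateConjecture.Theorems.SwallowTheDatum.UniversalWitnessFamily

open scoped Manifold ContDiff Topology
open Bundle Set Filter Function Metric Literature.Geometry.Lorentzian Literature.Geometry.Manifold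
open Summit.FinalStateConjecture.FinalStateConjecture.Theorems.SwallowTheDatum.ParametricKerrBurial
  (SmoothSectionsOn AgreeAt IsExactSchwarzschildBeyond IsSchwarzschildAnnulus)
open Summit.FinalStateConjecture.FinalStateConjecture.Theorems.SwallowTheDatum.UniversalWitnessFamily.ThroatSettlesToo
  (zero_notMem_exteriorRegion)

variable {X : Type} [TopologicalSpace X] [ChartedSpace E3 X] [IsManifold (𝓡 3) ∞ X]

/-! ## §1 A located throat shield on `ℝ³`, read through the chart of the sole end -/

/-- **A datum which beyond chart radius `R₀` is the `coord`-pullback of a datum `C` on `ℝ³` that is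
throat-shielded away from radius `ρ ≥ R₀` is throat-shielded**, with the same parameters `(M, R₁)`
(`e` the sole end): the shielding chart is `Φₑ ∘ Φ` (`Φₑ = e.dataChartExt`), smooth, an open
embedding with injective differentials (`dΦₑ` is injective beyond the chart radius), with
co-compact far zones (images of the open far zones `{R' < ‖y‖}` are ranges of `Φₑ ∘ (Φ ∘ incl)`),
and `(Φₑ ∘ Φ)^* D = Φ^*(Φₑ^* D) = Φ^* C` since beyond `R₀`, `Φₑ^*(coord^* F) = F`
(`AFEndChartEmbedding.lean`). O'Neill 1983, Ch. 3, p. 58; Bartnik 1986, §1. [folklore] -/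
theorem throatTransportPatch_shield_of_far_pullback (e : AFEnd X) (he : e.IsSoleEnd)
    (D : InitialDataSet (𝓡 3) X) (C : InitialDataSet (𝓡 3) E3) {R₀ ρ : ℝ} (hR₀ : e.R ≤ R₀)
    (hρ : R₀ ≤ ρ)
    (hDh : ∀ x ∈ e.far R₀, D.h.inner x = AFEnd.outerField e C.coordH x)
    (hDk : ∀ x ∈ e.far R₀, D.k x = AFEnd.outerField e C.coordK x)
    (hC : ∃ (M R₁ : ℝ) (hM : 0 < M) (hR : 0 < R₁), R₁ < M / 2 ∧
        ∃ (Φ : exteriorRegion R₁ → E3) (hΦ : ContMDiff 𝓘(ℝ, E3) (𝓡 3) (∞ + 1) Φ)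
          (hΦ' : ∀ u, Function.Injective (mfderiv 𝓘(ℝ, E3) (𝓡 3) Φ u)),
          (∀ y : exteriorRegion R₁, ρ < ‖Φ y‖) ∧
          Topology.IsOpenEmbedding Φ ∧
          (∀ R' : ℝ, IsCompact (Φ '' {y : exteriorRegion R₁ | R' < ‖(y : E3)‖})ᶜ) ∧
          C.comap Φ hΦ hΦ' = Schwarzschild.conformalData (M := M) (exteriorRegion R₁) hM.le
            (zero_notMem_exteriorRegion hR)) :
    ∃ (M R₁ : ℝ) (hM : 0 < M) (hR : 0 < R₁), R₁ < M / 2 ∧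
      ∃ (Φ : exteriorRegion R₁ → X) (hΦ : ContMDiff 𝓘(ℝ, E3) (𝓡 3) (∞ + 1) Φ)
        (hΦ' : ∀ u, Function.Injective (mfderiv 𝓘(ℝ, E3) (𝓡 3) Φ u)),
        Topology.IsOpenEmbedding Φ ∧
        (∀ R' : ℝ, IsCompact (Φ '' {y : exteriorRegion R₁ | R' < ‖(y : E3)‖})ᶜ) ∧
        D.comap Φ hΦ hΦ' = Schwarzschild.conformalData (M := M) (exteriorRegion R₁) hM.le
          (zero_notMem_exteriorRegion hR) := by
  obtain ⟨M, R₁, hM, hR, hRM, Φ, hΦ, hΦ', hloc, hopen, hfar, hexact⟩ := hC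
  -- the points `Φ y` lie beyond the chart radius and are sent by `Φₑ` into `far R₀`
  have hRΦ : ∀ y, e.R < ‖Φ y‖ := fun y ↦ lt_of_le_of_lt (hR₀.trans hρ) (hloc y)
  have hfarΦ : ∀ y, e.dataChartExt (Φ y) ∈ e.far R₀ := fun y ↦
    (e.dataChartExt_mem_far_iff (hRΦ y)).2 (lt_of_le_of_lt hρ (hloc y))
  -- the chain rule for the composed chart `Φₑ ∘ Φ`
  have hchain : ∀ u, mfderiv 𝓘(ℝ, E3) (𝓡 3) (e.dataChartExt ∘ Φ) u =
      (mfderiv 𝓘(ℝ, E3) (𝓡 3) e.dataChartExt (Φ u)).comp (mfderiv 𝓘(ℝ, E3) (𝓡 3) Φ u) := by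
    intro u
    have hg : MDifferentiableAt 𝓘(ℝ, E3) (𝓡 3) e.dataChartExt (Φ u) :=
      (e.contMDiffAt_dataChartExt (hRΦ u)).mdifferentiableAt (by simp)
    have hf : MDifferentiableAt 𝓘(ℝ, E3) (𝓡 3) Φ u := (hΦ u).mdifferentiableAt (by simp)
    exact mfderiv_comp u hg hf
  have hΨ : ContMDiff 𝓘(ℝ, E3) (𝓡 3) (∞ + 1) (e.dataChartExt ∘ Φ) := fun u ↦
    (e.contMDiffAt_dataChartExt (hRΦ u)).comp u (hΦ u)
  have hΨ' : ∀ u, Function.Injective (mfderiv 𝓘(ℝ, E3) (𝓡 3) (e.dataChartExt ∘ Φ) u) := by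
    intro u
    rw [hchain u]
    exact (e.injective_mfderiv_dataChartExt (hRΦ u)).comp (hΦ' u)
  refine ⟨M, R₁, hM, hR, hRM, e.dataChartExt ∘ Φ, hΨ, hΨ',
    e.isOpenEmbedding_dataChartExt_comp hopen hRΦ, fun R' ↦ ?_, ?_⟩
  · -- co-compact far zones: the image of the open far zone `S` is the range of `Φₑ ∘ (Φ ∘ incl)`
    set S : Set (exteriorRegion R₁) := {y | R' < ‖(y : E3)‖}
    have hSo : IsOpen S := isOpen_lt continuous_const continuous_subtype_val.norm
    have hf : Topology.IsOpenEmbedding (Φ ∘ (Subtype.val : S → exteriorRegion R₁)) :=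
      hopen.comp hSo.isOpenEmbedding_subtypeVal
    have hcpt : IsCompact (Set.range (Φ ∘ (Subtype.val : S → exteriorRegion R₁)))ᶜ := by
      rw [Set.range_comp, Subtype.range_coe]
      exact hfar R'
    have h := e.isCompact_compl_range_dataChartExt_comp he hf (fun a ↦ hRΦ a.1) hcpt
    rwa [← Function.comp_assoc, Set.range_comp, Subtype.range_coe] at h
  · -- the data identity `(Φₑ ∘ Φ)^* D = Φ^* C = conformalData M`
    refine InitialDataSet.ext' (fun u v w ↦ ?_) (fun u v w ↦ ?_)
    · have h1 := congrArg
        (fun D' : InitialDataSet 𝓘(ℝ, E3) (exteriorRegion R₁) ↦ D'.h.inner u v w) hexact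
      simp only [InitialDataSet.comap_h_inner] at h1
      have h2 : D.h.inner (e.dataChartExt (Φ u))
          (mfderiv 𝓘(ℝ, E3) (𝓡 3) e.dataChartExt (Φ u) (mfderiv 𝓘(ℝ, E3) (𝓡 3) Φ u v))
          (mfderiv 𝓘(ℝ, E3) (𝓡 3) e.dataChartExt (Φ u) (mfderiv 𝓘(ℝ, E3) (𝓡 3) Φ u w)) =
          C.h.inner (Φ u) (mfderiv 𝓘(ℝ, E3) (𝓡 3) Φ u v) (mfderiv 𝓘(ℝ, E3) (𝓡 3) Φ u w) :=
        DFunLike.congr_fun (DFunLike.congr_fun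
          (e.pullbackBilin_dataChartExt_apply_of_eq (hRΦ u) (hDh _ (hfarΦ u))) _) _
      rw [InitialDataSet.comap_h_inner, hchain u]
      exact h2.trans h1
    · have h1 := congrArg
        (fun D' : InitialDataSet 𝓘(ℝ, E3) (exteriorRegion R₁) ↦ D'.k u v w) hexact
      simp only [InitialDataSet.comap_k] at h1
      have h2 : D.k (e.dataChartExt (Φ u))
          (mfderiv 𝓘(ℝ, E3) (𝓡 3) e.dataChartExt (Φ u) (mfderiv 𝓘(ℝ, E3) (𝓡 3) Φ u v))
          (mfderiv 𝓘(ℝ, E3) (𝓡 3) e.dataChartExt (Φ u) (mfderiv 𝓘(ℝ, E3) (𝓡 3) Φ u w)) =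
          C.k (Φ u) (mfderiv 𝓘(ℝ, E3) (𝓡 3) Φ u v) (mfderiv 𝓘(ℝ, E3) (𝓡 3) Φ u w) :=
        DFunLike.congr_fun (DFunLike.congr_fun
          (e.pullbackBilin_dataChartExt_apply_of_eq (hRΦ u) (hDk _ (hfarΦ u))) _) _
      rw [InitialDataSet.comap_k, hchain u]
      exact h2.trans h1

/-! ## §2 The stub -/

/-- **Stub `stub_throatTransportPatch`** (registered signature, line `Sketch`, crux item
stmt-FinalStateConjecture-10051): patch the receding far-gluing family with the dilated bag family
across the isotropic Schwarzschild annulus, `l(R) = m R/μ`; the member `P R` is admissible (vacuum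
by locality of the constraints, its end the transplanted far end of the bag), THROAT-SHIELDED through
the chart of the sole end (`throatTransportPatch_shield_of_far_pullback` with `R₀ = 5 l(R)/4`,
`ρ = 2 l(R)`), equal to `G R` off `e.far (32R)`, and jointly smooth in `(R, x)`. Corvino 2000, §4;
Bartnik 1986, §1. [folklore] -/
theorem stub_throatTransportPatch :
    ∀ (X : Type) [TopologicalSpace X] [ChartedSpace E3 X] [IsManifold (𝓡 3) ∞ X] [T2Space X]
      [SecondCountableTopology X] [ConnectedSpace X] (e : AFEnd X) (Rstar η μ : ℝ) (m : ℝ → ℝ)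
      (G : ℝ → InitialDataSet (𝓡 3) X) (Cfam : ℝ → InitialDataSet (𝓡 3) E3),
      e.IsSoleEnd → e.R < Rstar → 0 < μ → 32 * μ ≤ η → ContDiff ℝ ∞ m →
      SmoothSectionsOn 𝓘(ℝ, ℝ) G {p : ℝ × X | Rstar < p.1} →
      (∀ R : ℝ, Rstar < R → G R ∈ admissibleVacuumData X ∧ η * R ≤ m R ∧
        IsExactSchwarzschildBeyond e (G R) (m R) (32 * R)) →
      SmoothSectionsOn 𝓘(ℝ, ℝ) Cfam {p : ℝ × E3 | 0 < p.1} →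
      (∀ l : ℝ, 0 < l → Cfam l ∈ admissibleVacuumData E3 ∧
        (∀ y : E3, l < ‖y‖ → ‖y‖ < 2 * l → (Cfam l).h.inner y =
            (1 + l * μ / (2 * ‖y‖)) ^ 4 • (innerSL ℝ : E3 →L[ℝ] E3 →L[ℝ] ℝ) ∧ (Cfam l).k y = 0) ∧
        ∃ (M R₁ : ℝ) (hM : 0 < M) (hR : 0 < R₁), R₁ < M / 2 ∧
          ∃ (Φ : exteriorRegion R₁ → E3) (hΦ : ContMDiff 𝓘(ℝ, E3) (𝓡 3) (∞ + 1) Φ)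
            (hΦ' : ∀ u, Function.Injective (mfderiv 𝓘(ℝ, E3) (𝓡 3) Φ u)),
            (∀ y : exteriorRegion R₁, 2 * l < ‖Φ y‖) ∧
            Topology.IsOpenEmbedding Φ ∧
            (∀ R' : ℝ, IsCompact (Φ '' {y : exteriorRegion R₁ | R' < ‖(y : E3)‖})ᶜ) ∧
            (Cfam l).comap Φ hΦ hΦ' = Schwarzschild.conformalData (M := M) (exteriorRegion R₁) hM.le
              (zero_notMem_exteriorRegion hR)) →
      ∃ P : ℝ → InitialDataSet (𝓡 3) X, SmoothSectionsOn 𝓘(ℝ, ℝ) P {p : ℝ × X | Rstar < p.1} ∧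
        ∀ R : ℝ, Rstar < R → P R ∈ admissibleVacuumData X ∧
          (∃ (M R₁ : ℝ) (hM : 0 < M) (hR : 0 < R₁), R₁ < M / 2 ∧
            ∃ (Φ : exteriorRegion R₁ → X) (hΦ : ContMDiff 𝓘(ℝ, E3) (𝓡 3) (∞ + 1) Φ)
              (hΦ' : ∀ u, Function.Injective (mfderiv 𝓘(ℝ, E3) (𝓡 3) Φ u)),
              Topology.IsOpenEmbedding Φ ∧
              (∀ R' : ℝ, IsCompact (Φ '' {y : exteriorRegion R₁ | R' < ‖(y : E3)‖})ᶜ) ∧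
              (P R).comap Φ hΦ hΦ' = Schwarzschild.conformalData (M := M) (exteriorRegion R₁) hM.le
                (zero_notMem_exteriorRegion hR)) ∧
          ∀ x ∉ e.far (32 * R), AgreeAt (P R) (G R) x := by
  -- adapted from `Theorems/SwallowTheDatumParametricKerrBurialStubTransportPatch.lean` (`stub_transportPatch`)
  intro X _ _ _ _ _ _ e Rstar η μ m G Cfam he heR hμ h32 hm hGs hG hCs hC
  classical
  -- the bag scale `l(R) = m R / μ ≥ 32 R`
  let l : ℝ → ℝ := fun R ↦ m R / μ
  have hlμ : ∀ R, l R * μ = m R := fun R ↦ div_mul_cancel₀ (m R) hμ.ne'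
  have hl32 : ∀ {R : ℝ}, Rstar < R → 32 * R ≤ l R := by
    intro R hR
    have h1 := (hG R hR).2.1
    rw [le_div_iff₀ hμ]
    nlinarith [e.R_pos]
  have hRpos : ∀ {R : ℝ}, Rstar < R → 0 < R := fun hR ↦ by linarith [e.R_pos]
  have hlpos : ∀ {R : ℝ}, Rstar < R → 0 < l R := fun hR ↦ by linarith [hl32 hR, hRpos hR]
  have hlcont : Continuous l := (hm.continuous).div_const μ
  -- the annulus patch data at each radius
  have hA : ∀ {R : ℝ}, Rstar < R →
      AFEnd.AnnulusPatchData e (G R) (Cfam (l R)) (32 * R) (l R) (m R) := by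
    intro R hR
    refine ⟨by linarith [hRpos hR], hl32 hR, hlpos hR, (hG R hR).2.2, fun y h1 h2 ↦ ?_⟩
    have h := ((hC (l R) (hlpos hR)).2.1 y h1 h2)
    rwa [hlμ R] at h
  -- the family
  let P : ℝ → InitialDataSet (𝓡 3) X := fun R ↦
    if h : Rstar < R then AFEnd.annulusPatch (hA h) else G R
  have hP : ∀ {R : ℝ} (h : Rstar < R), P R = AFEnd.annulusPatch (hA h) := fun h ↦ dif_pos h
  -- pointwise values of the sections of `P`
  have hPfar : ∀ {R : ℝ} (h : Rstar < R) {x : X}, x ∈ e.far (5 / 4 * l R) →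
      (P R).h.inner x = AFEnd.outerField e ((Cfam (l R)).coordH) x ∧
        (P R).k x = AFEnd.outerField e ((Cfam (l R)).coordK) x := by
    intro R h x hx
    rw [hP h]
    exact AFEnd.annulusPatch_eq_of_mem_far (hA h) hx
  have hPin : ∀ {R : ℝ} (h : Rstar < R) {x : X}, x ∉ e.closedFar (7 / 4 * l R) →
      (P R).h.inner x = (G R).h.inner x ∧ (P R).k x = (G R).k x := by
    intro R h x hx
    rw [hP h]
    exact ⟨AFEnd.patch_h_inner_of_not_mem_closedFar (AFEnd.annulusPatchData (hA h)) hx,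
      AFEnd.patch_k_of_not_mem_closedFar (AFEnd.annulusPatchData (hA h)) hx⟩
  refine ⟨P, ?_, fun R hR ↦ ⟨?_, ?_, fun x hx ↦ ?_⟩⟩
  · /- joint smoothness on `{R⋆ < R}`: near `(R, x)` with `x` inside, `P = G` on a product
      neighbourhood; with `x` far out, `P` is the outer family. -/
    -- the bag family as a smooth matrix-valued function of `(l, z)`
    have hopenE : IsOpen {p : ℝ × E3 | 0 < p.1} := isOpen_lt continuous_const continuous_fst
    have hCh : ContMDiffOn (𝓘(ℝ, ℝ).prod 𝓘(ℝ, E3)) 𝓘(ℝ, E3 →L[ℝ] E3 →L[ℝ] ℝ) ∞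
        (fun p : ℝ × E3 ↦ (Cfam p.1).coordH p.2) {p : ℝ × E3 | 0 < p.1} :=
      ((contMDiffOn_bilinSection_model_iff (IQ := 𝓘(ℝ, ℝ).prod 𝓘(ℝ, E3)) (b := fun p : ℝ × E3 ↦ p.2)
        (s := fun p : ℝ × E3 ↦ (Cfam p.1).coordH p.2) hopenE).1 hCs.1).2
    have hCk : ContMDiffOn (𝓘(ℝ, ℝ).prod 𝓘(ℝ, E3)) 𝓘(ℝ, E3 →L[ℝ] E3 →L[ℝ] ℝ) ∞
        (fun p : ℝ × E3 ↦ (Cfam p.1).coordK p.2) {p : ℝ × E3 | 0 < p.1} :=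
      ((contMDiffOn_bilinSection_model_iff (IQ := 𝓘(ℝ, ℝ).prod 𝓘(ℝ, E3)) (b := fun p : ℝ × E3 ↦ p.2)
        (s := fun p : ℝ × E3 ↦ (Cfam p.1).coordK p.2) hopenE).1 hCs.2).2
    have hopen : IsOpen {p : ℝ × X | Rstar < p.1} := isOpen_lt continuous_const continuous_fst
    -- generic argument for one of the two sections
    have key : ∀ (secP secG : Π q : ℝ × X, TangentSpace (𝓡 3) q.2 →L[ℝ] TangentSpace (𝓡 3) q.2 →L[ℝ] ℝ)
        (fld : InitialDataSet (𝓡 3) E3 → E3 → E3 →L[ℝ] E3 →L[ℝ] ℝ),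
        ContMDiffOn (𝓘(ℝ, ℝ).prod (𝓡 3)) ((𝓡 3).prod 𝓘(ℝ, E3 →L[ℝ] E3 →L[ℝ] ℝ)) ∞
          (fun q : ℝ × X ↦ TotalSpace.mk' (E3 →L[ℝ] E3 →L[ℝ] ℝ)
            (E := fun x : X ↦ TangentSpace (𝓡 3) x →L[ℝ] TangentSpace (𝓡 3) x →L[ℝ] ℝ) q.2 (secG q))
          {p : ℝ × X | Rstar < p.1} →
        ContMDiffOn (𝓘(ℝ, ℝ).prod 𝓘(ℝ, E3)) 𝓘(ℝ, E3 →L[ℝ] E3 →L[ℝ] ℝ) ∞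
          (fun p : ℝ × E3 ↦ fld (Cfam p.1) p.2) {p : ℝ × E3 | 0 < p.1} →
        (∀ q : ℝ × X, Rstar < q.1 → q.2 ∈ e.far (5 / 4 * l q.1) →
          secP q = AFEnd.outerField e (fld (Cfam (l q.1))) q.2) →
        (∀ q : ℝ × X, Rstar < q.1 → q.2 ∉ e.closedFar (7 / 4 * l q.1) → secP q = secG q) →
        ContMDiffOn (𝓘(ℝ, ℝ).prod (𝓡 3)) ((𝓡 3).prod 𝓘(ℝ, E3 →L[ℝ] E3 →L[ℝ] ℝ)) ∞
          (fun q : ℝ × X ↦ TotalSpace.mk' (E3 →L[ℝ] E3 →L[ℝ] ℝ)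
            (E := fun x : X ↦ TangentSpace (𝓡 3) x →L[ℝ] TangentSpace (𝓡 3) x →L[ℝ] ℝ) q.2 (secP q))
          {p : ℝ × X | Rstar < p.1} := by
      intro secP secG fld hGsec hfld hfar hin q hq
      obtain ⟨R, x⟩ := q
      have hR : Rstar < R := hq
      apply ContMDiffAt.contMDiffWithinAt
      -- a neighbourhood of `R` on which `l` moves by less than `l R / 8`
      have hl8 : 0 < l R / 8 := by linarith [hlpos hR]
      obtain ⟨δ, hδ, hδl⟩ := Metric.continuousAt_iff.1 hlcont.continuousAt (l R / 8) hl8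
      set N : Set ℝ := ball R δ ∩ Ioi Rstar with hN
      have hNopen : IsOpen N := isOpen_ball.inter isOpen_Ioi
      have hRN : R ∈ N := ⟨mem_ball_self hδ, hR⟩
      have hNl : ∀ R' ∈ N, |l R' - l R| < l R / 8 := fun R' hR' ↦ by
        have h := hδl hR'.1
        rwa [Real.dist_eq] at h
      set ρ' : ℝ := 3 / 2 * l R with hρ'
      by_cases hx : x ∈ e.closedFar ρ'
      · -- far out: `P = ` the outer family on `N × far (45/32 · l R)`
        obtain ⟨hxU, hxρ⟩ := hx
        have hxfar : x ∈ e.far (45 / 32 * l R) :=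
          e.mem_far_iff_coord.2 ⟨hxU, by linarith [hlpos hR]⟩
        -- the outer family is smooth at `(R, x)`
        have hc : ContMDiffAt (𝓘(ℝ, ℝ).prod 𝓘(ℝ, E3)) 𝓘(ℝ, E3 →L[ℝ] E3 →L[ℝ] ℝ) ∞
            (uncurry fun (R' : ℝ) (z : E3) ↦ fld (Cfam (l R')) z) (R, e.coord x) := by
          have h1 : ContMDiffAt (𝓘(ℝ, ℝ).prod 𝓘(ℝ, E3)) 𝓘(ℝ, E3 →L[ℝ] E3 →L[ℝ] ℝ) ∞
              (fun p : ℝ × E3 ↦ fld (Cfam p.1) p.2) (l R, e.coord x) :=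
            (hfld _ (hlpos hR)).contMDiffAt (hopenE.mem_nhds (hlpos hR))
          have h2 : ContMDiffAt (𝓘(ℝ, ℝ).prod 𝓘(ℝ, E3)) (𝓘(ℝ, ℝ).prod 𝓘(ℝ, E3)) ∞
              (fun p : ℝ × E3 ↦ (l p.1, p.2)) (R, e.coord x) :=
            ((hm.div_const μ).contMDiff.contMDiffAt.comp _ contMDiffAt_fst).prodMk contMDiffAt_snd
          exact h1.comp (R, e.coord x) h2
        have hsm := e.contMDiffAt_outerField_family (IP := 𝓘(ℝ, ℝ))
          (c := fun (R' : ℝ) (z : E3) ↦ fld (Cfam (l R')) z) hxU hc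
        refine hsm.congr_of_eventuallyEq ?_
        have hev : ∀ᶠ q : ℝ × X in 𝓝 (R, x), q.1 ∈ N ∧ q.2 ∈ e.far (45 / 32 * l R) :=
          prod_mem_nhds (hNopen.mem_nhds hRN) ((e.isOpen_far _).mem_nhds hxfar)
        filter_upwards [hev] with q hq
        have hq1 : Rstar < q.1 := hq.1.2
        have hql := abs_lt.1 (hNl q.1 hq.1)
        have hq2 : q.2 ∈ e.far (5 / 4 * l q.1) := by
          refine e.far_mono ?_ hq.2
          linarith
        rw [hfar q hq1 hq2]
      · -- inside: `P = G` on `N × (closedFar ρ')ᶜ`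
        have hρ'R : e.R < ρ' := by
          have := hl32 hR; have := hRpos hR; rw [hρ']; linarith [heR, e.R_pos]
        have hGat : ContMDiffAt (𝓘(ℝ, ℝ).prod (𝓡 3)) ((𝓡 3).prod 𝓘(ℝ, E3 →L[ℝ] E3 →L[ℝ] ℝ)) ∞
            (fun q : ℝ × X ↦ TotalSpace.mk' (E3 →L[ℝ] E3 →L[ℝ] ℝ)
              (E := fun x : X ↦ TangentSpace (𝓡 3) x →L[ℝ] TangentSpace (𝓡 3) x →L[ℝ] ℝ) q.2 (secG q))
              (R, x) :=
          (hGsec _ hR).contMDiffAt (hopen.mem_nhds hR)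
        refine hGat.congr_of_eventuallyEq ?_
        have hev : ∀ᶠ q : ℝ × X in 𝓝 (R, x), q.1 ∈ N ∧ q.2 ∉ e.closedFar ρ' :=
          prod_mem_nhds (hNopen.mem_nhds hRN) ((e.isClosed_closedFar hρ'R).isOpen_compl.mem_nhds hx)
        filter_upwards [hev] with q hq
        have hq1 : Rstar < q.1 := hq.1.2
        have hql := abs_lt.1 (hNl q.1 hq.1)
        have hq2 : q.2 ∉ e.closedFar (7 / 4 * l q.1) := by
          intro hmem
          obtain ⟨hU, hle⟩ := hmem
          exact hq.2 ⟨hU, by linarith⟩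
        rw [hin q hq1 hq2]
    refine ⟨key (fun q ↦ (P q.1).h.inner q.2) (fun q ↦ (G q.1).h.inner q.2) InitialDataSet.coordH hGs.1 hCh
        (fun q h hx ↦ (hPfar h hx).1) (fun q h hx ↦ (hPin h hx).1),
      key (fun q ↦ (P q.1).k q.2) (fun q ↦ (G q.1).k q.2) InitialDataSet.coordK hGs.2 hCk
        (fun q h hx ↦ (hPfar h hx).2) (fun q h hx ↦ (hPin h hx).2)⟩
  · -- admissibility
    rw [hP hR]
    obtain ⟨hGadm, -, -⟩ := hG R hR
    have hGvac : ∀ [(G R).metric.HasLeviCivita], (G R).IsVacuumConstraintSolution :=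
      fun {inst} ↦ (hGadm.1).1
    exact AFEnd.annulusPatch_mem_admissibleVacuumData (hA hR) he hGvac (hC (l R) (hlpos hR)).1
  · -- the throat shield, read through the chart of the end
    have h54 : e.R ≤ 5 / 4 * l R := by linarith [hl32 hR, hRpos hR, heR]
    exact throatTransportPatch_shield_of_far_pullback e he (P R) (Cfam (l R)) h54
      (by linarith [hlpos hR]) (fun x hx ↦ (hPfar hR hx).1) (fun x hx ↦ (hPfar hR hx).2)
      (hC (l R) (hlpos hR)).2.2
  · -- agreement with `G R` off `e.far (32 R)`
    have hx' : x ∉ e.far (5 / 4 * l R) := fun h ↦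
      hx (e.far_mono (by linarith [hl32 hR, hRpos hR]) h)
    rw [hP hR]
    exact AFEnd.annulusPatch_eq_of_not_mem_far (hA hR) hx'

end Summit.FinalStateConjecture.FinalStateConjecture.Theorems.SwallowTheDatum.UniversalWitnessFamily

end
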